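import Literature.NumberTheory.EllipticCurves.AtkinLehnerSymbolSymmetryProofs
import Literature.NumberTheory.EllipticCurves.PAdicLFunctionMinusMult
import HarnessLib

/-!
# The Atkin–Lehner symmetry of the MINUS modular symbols `[u/m]⁻` (denominator divisible by `N/Q`),
# and of the one-term minus Mazur–Tate–Teitelbaum measure `μ⁻_{f,α}` at a prime `p ‖ N`

Topic `NumberTheory/EllipticCurves`. Proofs-companion (theorems only: no definition, no named fact;
D-0014/D-0026) of `AtkinLehnerSymbolSymmetryProofs` — which proves the Atkin–Lehner symmetry
`{∞, u/m}_f = −ε {∞, v/m}_f` (`w_Q f = ε f`, `N ∣ Q m`, `a m − u Q v = 1`;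
`modularSymbol_div_eq_neg_mul_atkinLehner`) and its PLUS-symbol consequences down to
`ratPlusSymbol_eq_mul_of_atkinLehner_of_dvd` (`[u/p^L]⁺ = σ [u'/p^L]⁺` for `M u u' ≡ −1`, `N = pM`,
`w_M f = −σ f`) — for the MINUS side: the minus symbol `minusSymbol f r = ({∞, r} − {∞, −r})/2`, its
normalisation `normalizedMinusSymbol f r = im(minusSymbol f r)/Ω⁻_f`, the rational minus symbol
`ratMinusSymbol f r = [r]⁻_f` of `PAdicLFunctionMinus`, and the ONE-term minus measure
`msdMinusMeasureMult f α n a = α⁻ⁿ [a/pⁿ]⁻_f` of `PAdicLFunctionMinusMult` (Mazur–Tate–Teitelbaum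
1986, §I.10 (10.1) with `ε(p) = 0`). This is the first layer of the functional equation of the ODD
`ω`-branches `L⁻_p(f, α, ω^i, T)` of the `p`-adic `L`-function at a prime `p ‖ N` of multiplicative
reduction (Mazur–Tate–Teitelbaum 1986, §I.17), assembled in
`PAdicLFunctionMinusMultFunctionalEquationProofs`.

* `minusSymbol_div_eq_neg_mul_atkinLehner` — `minusSymbol f (u/m) = −ε · minusSymbol f (v/m)`
  (the raw relation applied to `(u, v)` and to `(−u, −v)`);
* `normalizedMinusSymbol_div_eq_mul_atkinLehner` — `[u/m]⁻ = σ [v/m]⁻` in `ℝ` for `w_Q f = −σ f`,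
  `σ ∈ ℤ`, `σ² = 1`;
* `ratMinusSymbol_eq_mul_of_normalizedMinusSymbol_eq` — a sign relation between the real symbols
  passes to the rational symbols (twin of `ratPlusSymbol_eq_mul_of_normalizedPlusSymbol_eq`; no
  Manin–Drinfeld hypothesis);
* `ratMinusSymbol_div_eq_mul_atkinLehner` — `[u/m]⁻_f = σ [v/m]⁻_f` for the rational symbols;
* `ratMinusSymbol_eq_mul_of_atkinLehner_of_dvd` — **at `p ‖ N`, `N = pM`, `w_M f = −σ f`:
  `[u/p^L]⁻ = σ [u'/p^L]⁻` whenever `M u u' ≡ −1 (mod p^L)`**, `L ≥ 1`;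
* `msdMinusMeasureMult_eq_mul_of_atkinLehner` — hence **`μ⁻_{f,α}(u + p^Lℤ_p) = σ μ⁻_{f,α}(u' + p^Lℤ_p)`**:
  the one-term minus measure is `σ`-symmetric under the involution `x ↦ −1/(Mx)` of `ℤ_p^×`.

## References

* B. Mazur, J. Tate, J. Teitelbaum, *On `p`-adic analogues of the conjectures of Birch and
  Swinnerton-Dyer*, Invent. Math. 84 (1986), 1–48, §I.8 (`[a/m]^±`), §I.10 ((10.1), `ε(p) = 0` for
  `p ∣ N`), §I.17 (functional equation). [MazurTateTeitelbaum1986Invent]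
* A. W. Knapp, *Elliptic curves*, Math. Notes 40, Princeton UP 1993, Lemma 9.24, Thm. 9.27. [Knapp1993]
* A. O. L. Atkin, J. Lehner, *Hecke operators on `Γ₀(m)`*, Math. Ann. 185 (1970), Lemmas 8–10, Thm. 3.
-/

noncomputable section

open scoped MatrixGroups ModularForm

open CongruenceSubgroup

namespace Literature.NumberTheory.EllipticCurves.ModularForms

/-! ### The minus symbols -/

section Symbols

variable {N : ℕ} [NeZero N] {Q : ℕ} [NeZero Q]

/-- **Atkin–Lehner symmetry of the minus symbols**: `({∞, u/m} − {∞, −u/m})/2 =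
−ε ({∞, v/m} − {∞, −v/m})/2` under the hypotheses of `modularSymbol_div_eq_neg_mul_atkinLehner`
(`Q ∥ N`, `w_Q f = ε f`, `ε² = 1`, `m ≥ 1`, `N ∣ Q m`, `a m − u Q v = 1`): apply the symbol relation to
`(u, v)` and to `(−u, −v)` (the determinant relation is the same). Minus twin of
`plusSymbol_div_eq_neg_mul_atkinLehner` (Mazur–Tate–Teitelbaum 1986, §I.17).
[cite: MazurTateTeitelbaum1986Invent, §I.17] -/
theorem minusSymbol_div_eq_neg_mul_atkinLehner (hQN : Q ∣ N) (hc : Nat.Coprime Q (N / Q))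
    (f : CuspForm (Gamma0 N) 2) {ε : ℂ} (hε : atkinLehnerInvolution N 2 Q f = ε • f)
    (hε1 : ε ^ 2 = 1) {m : ℕ} (hm : 0 < m) (hNm : N ∣ Q * m) {a u v : ℤ}
    (huv : a * m - u * (Q * v) = 1) :
    minusSymbol f ((u : ℚ) / m) = -ε * minusSymbol f ((v : ℚ) / m) := by
  have h1 := modularSymbol_div_eq_neg_mul_atkinLehner hQN hc f hε hε1 hm hNm huv
  have huv' : a * m - (-u) * (Q * (-v)) = 1 := by linear_combination huv
  have h2 := modularSymbol_div_eq_neg_mul_atkinLehner hQN hc f hε hε1 hm hNm huv'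
  have hu : (((-u : ℤ) : ℚ) / m) = -((u : ℚ) / m) := by push_cast; ring
  have hv : (((-v : ℤ) : ℚ) / m) = -((v : ℚ) / m) := by push_cast; ring
  rw [hu, hv] at h2
  simp only [minusSymbol]
  rw [h1, h2]
  ring

/-- **Atkin–Lehner symmetry of the normalised minus symbols `[r]⁻ = im(minusSymbol)/Ω⁻_f`**, the
sign written as an integer: if `w_Q f = −σ f` with `σ ∈ ℤ`, `σ² = 1`, `m ≥ 1`, `N ∣ Q m` and
`a m − u Q v = 1`, then `[u/m]⁻_f = σ [v/m]⁻_f` in `ℝ`. Minus twin of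
`normalizedPlusSymbol_div_eq_mul_atkinLehner`. [cite: MazurTateTeitelbaum1986Invent, §I.17] -/
theorem normalizedMinusSymbol_div_eq_mul_atkinLehner (hQN : Q ∣ N) (hc : Nat.Coprime Q (N / Q))
    (f : CuspForm (Gamma0 N) 2) {σ : ℤ} (hε : atkinLehnerInvolution N 2 Q f = (-(σ : ℂ)) • f)
    (hσ : σ ^ 2 = 1) {m : ℕ} (hm : 0 < m) (hNm : N ∣ Q * m) {a u v : ℤ}
    (huv : a * m - u * (Q * v) = 1) :
    normalizedMinusSymbol f ((u : ℚ) / m) = σ * normalizedMinusSymbol f ((v : ℚ) / m) := by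
  have hε1 : (-(σ : ℂ)) ^ 2 = 1 := by rw [neg_sq]; exact_mod_cast hσ
  have h := minusSymbol_div_eq_neg_mul_atkinLehner hQN hc f hε hε1 hm hNm huv
  rw [neg_neg] at h
  simp only [normalizedMinusSymbol]
  rw [h, ← Complex.ofReal_intCast, Complex.im_ofReal_mul, mul_div_assoc]

end Symbols

end Literature.NumberTheory.EllipticCurves.ModularForms

namespace Literature.NumberTheory.EllipticCurves

open ModularForms

/-! ### The rational minus symbols `[r]⁻_f = ratMinusSymbol f r` -/

section RatSymbol

variable {N : ℕ} (f : CuspForm (Gamma0 N) 2)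

/-- **A sign relation between real minus symbols passes to the rational minus symbols**: if
`[r]⁻_f = σ [r']⁻_f` in `ℝ` with `σ ∈ ℤ`, `σ² = 1`, then `ratMinusSymbol f r = σ · ratMinusSymbol f r'`
— the rational symbols are, by definition, the rational values of the real symbols when rational and
`0` otherwise, and `[r]⁻_f` is rational iff `[r']⁻_f = σ [r]⁻_f` is. Twin of
`ratPlusSymbol_eq_mul_of_normalizedPlusSymbol_eq`; no Manin–Drinfeld hypothesis is needed (Mazur–Tate–Teitelbaum
1986, §I.8: the symbols `[a/m]⁻` are rational). [cite: MazurTateTeitelbaum1986Invent, §I.8] -/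
theorem ratMinusSymbol_eq_mul_of_normalizedMinusSymbol_eq {r r' : ℚ} {σ : ℤ} (hσ : σ ^ 2 = 1)
    (h : normalizedMinusSymbol f r = σ * normalizedMinusSymbol f r') :
    ratMinusSymbol f r = σ * ratMinusSymbol f r' := by
  classical
  unfold ratMinusSymbol
  by_cases h' : ∃ q : ℚ, (q : ℝ) = normalizedMinusSymbol f r'
  · have h1 : ∃ q : ℚ, (q : ℝ) = normalizedMinusSymbol f r := by
      obtain ⟨q', hq'⟩ := h'
      refine ⟨σ * q', ?_⟩
      push_cast
      rw [h, ← hq']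
    rw [dif_pos h1, dif_pos h']
    apply Rat.cast_injective (α := ℝ)
    push_cast
    rw [h1.choose_spec, h'.choose_spec, h]
  · have h1 : ¬ ∃ q : ℚ, (q : ℝ) = normalizedMinusSymbol f r := by
      rintro ⟨q, hq⟩
      refine h' ⟨σ * q, ?_⟩
      have hσ' : ((σ : ℝ)) ^ 2 = 1 := by exact_mod_cast hσ
      push_cast
      rw [hq, h, ← mul_assoc, ← sq, hσ', one_mul]
    rw [dif_neg h1, dif_neg h']
    simp

variable [NeZero N] {Q : ℕ} [NeZero Q]

/-- **Atkin–Lehner symmetry of the rational minus symbols** `[r]⁻ = ratMinusSymbol f r` of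
`PAdicLFunctionMinus`: `[u/m]⁻_f = σ [v/m]⁻_f` under `Q ∥ N`, `w_Q f = −σ f`, `σ² = 1`, `m ≥ 1`,
`N ∣ Q m`, `a m − u Q v = 1` (transport of `normalizedMinusSymbol_div_eq_mul_atkinLehner` by
`ratMinusSymbol_eq_mul_of_normalizedMinusSymbol_eq`). [cite: MazurTateTeitelbaum1986Invent, §I.17] -/
theorem ratMinusSymbol_div_eq_mul_atkinLehner (hQN : Q ∣ N) (hc : Nat.Coprime Q (N / Q))
    {σ : ℤ} (hε : atkinLehnerInvolution N 2 Q f = (-(σ : ℂ)) • f)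
    (hσ : σ ^ 2 = 1) {m : ℕ} (hm : 0 < m) (hNm : N ∣ Q * m) {a u v : ℤ}
    (huv : a * m - u * (Q * v) = 1) :
    ratMinusSymbol f ((u : ℚ) / m) = σ * ratMinusSymbol f ((v : ℚ) / m) :=
  ratMinusSymbol_eq_mul_of_normalizedMinusSymbol_eq f hσ
    (normalizedMinusSymbol_div_eq_mul_atkinLehner hQN hc f hε hσ hm hNm huv)

end RatSymbol

/-! ### The symmetry of `[u/p^L]⁻` and of `μ⁻_{f,α}` under `u ↦ −1/(Mu)` at a prime `p ‖ N`, `N = pM` -/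

section Measure

variable {N : ℕ} [NeZero N] {f : CuspForm (Gamma0 N) 2} {p : ℕ} [Fact p.Prime]

/-- **The Atkin–Lehner symmetry of the symbols `[u/p^L]⁻` at a prime `p ‖ N`** (Mazur–Tate–
Teitelbaum 1986, §I.17, the involution behind the functional equation of the odd branches of `L_p`
at a prime of multiplicative reduction): let `N = pM` with `p ∤ M` (so `M ∥ N`), let
`f ∈ S₂(Γ₀(N))` satisfy `w_M f = −σ f` with `σ ∈ ℤ`, `σ² = 1`, let `L ≥ 1`, and let `u, u'` be
classes modulo `p^L` with `M u u' = −1`. Then `[u/p^L]⁻ = σ [u'/p^L]⁻` for the rational minus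
symbols of `PAdicLFunctionMinus` (`N = pM ∣ M p^L`; the determinant relation `A p^L − u M u' = 1` for
the representatives in `[0, p^L)`). Minus twin of `ratPlusSymbol_eq_mul_of_atkinLehner_of_dvd`.
[cite: MazurTateTeitelbaum1986Invent, §I.17] [cite: Knapp1993, Lemma 9.24] -/
theorem ratMinusSymbol_eq_mul_of_atkinLehner_of_dvd {M : ℕ} [NeZero M] (hNM : N = p * M)
    (hpM : ¬ p ∣ M) {σ : ℤ} (hσ : σ ^ 2 = 1)
    (hW : atkinLehnerInvolution N 2 M f = (-(σ : ℂ)) • f) {L : ℕ} (hL : 1 ≤ L)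
    {u u' : ZMod (p ^ L)} (h : (M : ZMod (p ^ L)) * u * u' = -1) :
    ratMinusSymbol f ((u.val : ℚ) / (p : ℚ) ^ L) =
      σ * ratMinusSymbol f ((u'.val : ℚ) / (p : ℚ) ^ L) := by
  haveI : NeZero (p ^ L) := ⟨pow_ne_zero _ (Fact.out : p.Prime).ne_zero⟩
  have hp : p.Prime := Fact.out
  -- `M ∥ N`
  have hMN : M ∣ N := ⟨p, by rw [hNM, mul_comm]⟩
  have hNdM : N / M = p := by
    rw [hNM, Nat.mul_div_cancel _ (NeZero.pos M)]
  have hc : Nat.Coprime M (N / M) := by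
    rw [hNdM]
    exact (Nat.Coprime.symm ((hp.coprime_iff_not_dvd).mpr hpM))
  -- `N ∣ M p^L`
  have hNm : N ∣ M * p ^ L := by
    obtain ⟨L', rfl⟩ : ∃ L', L = L' + 1 := ⟨L - 1, by omega⟩
    rw [hNM, pow_succ]
    exact ⟨p ^ L', by ring⟩
  -- `M a b ≡ -1 mod p^L` for the representatives `a = u.val`, `b = u'.val`
  have hdvd : ((p ^ L : ℕ) : ℤ) ∣ (M : ℤ) * u.val * u'.val + 1 := by
    rw [← ZMod.intCast_zmod_eq_zero_iff_dvd]
    push_cast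
    rw [ZMod.natCast_zmod_val, ZMod.natCast_zmod_val, h, neg_add_cancel]
  obtain ⟨A, hA⟩ := hdvd
  have h1 : A * ((p ^ L : ℕ) : ℤ) - (u.val : ℤ) * (M * (u'.val : ℤ)) = 1 := by
    linear_combination -hA
  have k1 := ratMinusSymbol_div_eq_mul_atkinLehner f hMN hc hW hσ (pow_pos hp.pos L) hNm h1
  push_cast at k1
  exact k1

/-- **The one-term minus measure is `σ`-symmetric under `x ↦ −1/(Mx)` at a prime `p ‖ N`**:
`μ⁻_{f,α}(u + p^Lℤ_p) = σ · μ⁻_{f,α}(u' + p^Lℤ_p)` whenever `M u u' = −1 (mod p^L)`, `L ≥ 1`, for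
`μ⁻_{f,α} = msdMinusMeasureMult f α` (`= α^{-L}[u/p^L]⁻`, Mazur–Tate–Teitelbaum 1986 §I.10 (10.1)
with `ε(p) = 0`), `N = pM`, `p ∤ M`, `w_M f = −σ f` — the hypothesis `hsym` of the measure-generic
functional equation `subst_eq_of_measure_symmetry` with modulus `K = M`. For the newform of an
elliptic curve with multiplicative reduction at `p`, `σ = −ε_M = −a_p · w_E`.
[cite: MazurTateTeitelbaum1986Invent, §I.10 (10.1) and §I.17] -/
theorem msdMinusMeasureMult_eq_mul_of_atkinLehner {M : ℕ} [NeZero M] (hNM : N = p * M)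
    (hpM : ¬ p ∣ M) {σ : ℤ} (hσ : σ ^ 2 = 1)
    (hW : atkinLehnerInvolution N 2 M f = (-(σ : ℂ)) • f) (α : ℚ_[p]) {L : ℕ} (hL : 1 ≤ L)
    {u u' : ZMod (p ^ L)} (h : (M : ZMod (p ^ L)) * u * u' = -1) :
    msdMinusMeasureMult f α L u = (σ : ℚ_[p]) * msdMinusMeasureMult f α L u' := by
  simp only [msdMinusMeasureMult]
  rw [ratMinusSymbol_eq_mul_of_atkinLehner_of_dvd hNM hpM hσ hW hL h]
  push_cast
  ring

end Measure

end Literature.NumberTheory.EllipticCurves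

end
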